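import Literature.MathematicalPhysics.QuantumLattice.DWaveSource
import Literature.MathematicalPhysics.QuantumLattice.DWaveSourceProofs
import Literature.MathematicalPhysics.QuantumLattice.DWaveOrderParameterProofs
import Literature.MathematicalPhysics.QuantumLattice.GroundStateSourceBounds
import HarnessLib

/-!
# WeakCouplingBCS / crux `WcbcsSsbToTorusLRO` (stmt-HubbardSuperconductivity-2009), line
`quenched-corner-by-square-completion` — the glue stub `stub_gcSharpOfAHM`

Write `P = pairField dWaveFormFactor L`, `K_μ = hubbardTorusWith 2 L 1 U μ`,
`S_h = dWaveSourceTorus L U μ h = K_μ - h(P + Pᴴ)`, `Q_t = K_μ - (t/L²) Pᴴ P`, `E = Matrix.groundEnergy`,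
`dens_L(h) = dWaveSourceDensity L U μ h`, `F(h) = liminf_L dens_{L+1}(h)` and
`m = dWaveOrderParameter U μ = ⨅_{h>0} F(h)` (`dWaveOrderParameter_eq_iInf`).

The stub: the `T = 0` approximating-Hamiltonian formula (hypothesis; route item
`DeformationLadder.ApproximatingHamiltonianGC`) — `E(S_h)(L+1)/(L+1)² → e(h)` for `h ≥ 0` and
`E(Q_t)(L+1)/(L+1)² → ⨅_{h ≥ 0} [e(h) + h²/t]` — implies that the grand-canonical quenched corner is
SHARP: for every `ε > 0`, all small `t > 0` and all large `L`,
`E(K_μ) - E(Q_t) ≤ t (m² + ε) L²` (the matching lower bound `≥ t m²(1-4η)L²` is the line's lever).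

Proof (soft convex analysis, no many-body input beyond the tree's energy sandwich of
`DWaveSourceProofs`): with `D(h) = e(0) - e(h)`,
* the finite-`L` sandwich `(E(0)-E(h))/(2hL²) ≤ dens(h)` and `(h₂-h)·2L²dens(h) ≤ E(h)-E(h₂)` give in
  the limit `D(h) ≤ 2h F(h)` and the chord monotonicity `h₂ D(h) ≤ h D(h₂)` (`0 < h < h₂`);
* `m = ⨅_{h>0} F` gives `h₀ > 0` with `F(h₀) < m + ε₁`, hence `D(h) ≤ 2h(m+ε₁)` on `(0, h₀]`, and
  `D(h) ≤ 2hB` everywhere (`B = 4√2` the a priori bound);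
* completing the square, `e(h) + h²/t ≥ e(0) - t(m+ε₁)²` for every `h ≥ 0` once `t(2B+1) ≤ h₀`;
* so `[E(K_μ) - E(Q_t)]/(L+1)² → e(0) - ⨅(…) ≤ t(m+ε₁)² < t(m²+ε)`.

Koma–Tasaki, J. Stat. Phys. 76 (1994) 745, §1 (order parameter under a source; concavity of the sourced
ground-state energy); Bogoliubov Jr., Physica 32 (1966) 933 (approximating Hamiltonian). No definition is
introduced; the helper lemmas are private.
-/

noncomputable section

set_option linter.dupNamespace false

namespace Summit.HubbardSuperconductivity.HubbardSuperconductivity.Theorems.WcbcsSsbToTorusLRO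

open Literature.MathematicalPhysics.QuantumLattice Filter
open scoped Matrix ComplexOrder Topology

/-! ### Real-analysis helpers -/

/-- Completing the square: chord bounds `e 0 - e h ≤ 2h a` on `(0, h₀]` and `e 0 - e h ≤ 2hB` on
`(0, ∞)` give `e 0 - t a² ≤ ⨅_{h ≥ 0} (e h + h²/t)` once `t (2B+1) ≤ h₀`. [folklore] -/
private theorem sub_mul_sq_le_ciInf {e : ℝ → ℝ} {t h₀ a B : ℝ} (ht : 0 < t)
    (htB : t * (2 * B + 1) ≤ h₀)
    (hsmall : ∀ h : ℝ, 0 < h → h ≤ h₀ → e 0 - e h ≤ 2 * h * a)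
    (hlarge : ∀ h : ℝ, 0 < h → e 0 - e h ≤ 2 * h * B) :
    e 0 - t * a ^ 2 ≤ ⨅ h : {h : ℝ // 0 ≤ h}, e h + (h : ℝ) ^ 2 / t := by
  haveI : Nonempty {h : ℝ // 0 ≤ h} := ⟨⟨0, le_rfl⟩⟩
  refine le_ciInf fun x => ?_
  obtain ⟨h, hh⟩ := x
  dsimp only
  have hta : 0 ≤ t * a ^ 2 := by positivity
  rcases hh.eq_or_lt with rfl | hpos
  · have : (0 : ℝ) ^ 2 / t = 0 := by simp
    rw [this]
    linarith
  rcases le_or_gt h h₀ with hle | hgt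
  · have h1 := hsmall h hpos hle
    have key : 2 * h * a ≤ t * a ^ 2 + h ^ 2 / t := by
      have : t * a ^ 2 + h ^ 2 / t = (t ^ 2 * a ^ 2 + h ^ 2) / t := by
        field_simp
      rw [this, le_div_iff₀ ht]
      nlinarith [sq_nonneg (t * a - h)]
    linarith
  · have h1 := hlarge h hpos
    have key : 2 * h * B ≤ h ^ 2 / t := by
      rw [le_div_iff₀ ht]
      nlinarith
    linarith

/-- Limit of the lower half of the energy sandwich: if `E_L(0)/c_L → e 0`, `E_L(h)/c_L → e h` and
`(E_L(0) - E_L(h))/(2h c_L) ≤ d_L ≤ C`, then `e 0 - e h ≤ 2h · liminf d`. [folklore] -/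
private theorem sub_le_mul_liminf {E : ℕ → ℝ → ℝ} {c d : ℕ → ℝ} {e : ℝ → ℝ} {h C : ℝ}
    (hh : 0 < h) (hc : ∀ L, 0 < c L)
    (h0 : Tendsto (fun L => E L 0 / c L) atTop (𝓝 (e 0)))
    (h1 : Tendsto (fun L => E L h / c L) atTop (𝓝 (e h)))
    (hle : ∀ L, (E L 0 - E L h) / (2 * h * c L) ≤ d L) (hd : ∀ L, d L ≤ C) :
    e 0 - e h ≤ 2 * h * liminf d atTop := by
  have hs : Tendsto (fun L => (E L 0 - E L h) / (2 * h * c L)) atTop (𝓝 ((e 0 - e h) / (2 * h))) := by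
    refine ((h0.sub h1).div_const (2 * h)).congr fun L => ?_
    have hcL := (hc L).ne'
    field_simp
  have h2 : (e 0 - e h) / (2 * h) ≤ liminf d atTop := by
    rw [← hs.liminf_eq]
    exact liminf_le_liminf (Eventually.of_forall hle) hs.isBoundedUnder_ge
      (isCoboundedUnder_ge_of_eventually_le atTop (Eventually.of_forall hd))
  have h3 := (div_le_iff₀ (by positivity : (0 : ℝ) < 2 * h)).1 h2
  linarith

/-- Limit of the chord monotonicity: if `E_L(·)/c_L → e(·)` at `0, h, h₂` and
`h₂ (E_L(0) - E_L(h)) ≤ h (E_L(0) - E_L(h₂))`, then `h₂ (e 0 - e h) ≤ h (e 0 - e h₂)`. [folklore] -/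
private theorem chord_mono_of_tendsto {E : ℕ → ℝ → ℝ} {c : ℕ → ℝ} {e : ℝ → ℝ} {h h₂ : ℝ}
    (hc : ∀ L, 0 < c L)
    (h0 : Tendsto (fun L => E L 0 / c L) atTop (𝓝 (e 0)))
    (h1 : Tendsto (fun L => E L h / c L) atTop (𝓝 (e h)))
    (h2 : Tendsto (fun L => E L h₂ / c L) atTop (𝓝 (e h₂)))
    (hle : ∀ L, h₂ * (E L 0 - E L h) ≤ h * (E L 0 - E L h₂)) :
    h₂ * (e 0 - e h) ≤ h * (e 0 - e h₂) := by
  refine le_of_tendsto_of_tendsto' ((h0.sub h1).const_mul h₂) ((h0.sub h2).const_mul h) fun L => ?_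
  rw [← sub_div, ← sub_div, ← mul_div_assoc, ← mul_div_assoc]
  exact div_le_div_of_nonneg_right (hle L) (hc L).le

/-! ### Finite-volume chord inequality -/

/-- Finite-`L` chord monotonicity from the two halves of the energy sandwich:
`h₂ (E(0) - E(h)) ≤ h (E(0) - E(h₂))` for `0 < h < h₂` (concavity of `h ↦ E(S_h)`; Koma–Tasaki 1994, §1).
[folklore] -/
private theorem chord_mono_finite (L : ℕ) [NeZero L] (U μ : ℝ) {h h₂ : ℝ} (hh : 0 < h)
    (hlt : h < h₂) :
    h₂ * ((dWaveSourceTorus L U μ 0).groundEnergy - (dWaveSourceTorus L U μ h).groundEnergy) ≤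
      h * ((dWaveSourceTorus L U μ 0).groundEnergy - (dWaveSourceTorus L U μ h₂).groundEnergy) := by
  have g1 := groundEnergy_gain_le_dWaveSourceDensity (L := L) U μ h
  have g2 := dWaveSourceDensity_mul_le_groundEnergy_drop (L := L) U μ h h₂
  have hsub : 0 ≤ h₂ - h := sub_nonneg.2 hlt.le
  nlinarith [mul_le_mul_of_nonneg_left g1 hsub, mul_le_mul_of_nonneg_left g2 hh.le]

/-! ### The stub -/

/-- **Stub (T1) of line `quenched-corner-by-square-completion` — the grand-canonical quenched corner is
sharp, given the `T = 0` approximating-Hamiltonian formula.** If for all `U ≥ 0`, `μ`, `g > 0` the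
sourced energy densities converge, `E(S_h)(L+1)/(L+1)² → e(h)` (`h ≥ 0`), and the quenched energy density
converges to the Bogoliubov variational value `⨅_{h ≥ 0} [e(h) + h²/g]`, then for every `ε > 0` there is
`t₀ > 0` such that for all `t ∈ (0, t₀)` and all large `L`,
`E(K_μ) - E(K_μ - (t/L²)PᴴP) ≤ t (m² + ε) L²`, `m = dWaveOrderParameter U μ`.
Koma–Tasaki, J. Stat. Phys. 76 (1994) 745, §1; Bogoliubov Jr., Physica 32 (1966) 933. [folklore] -/
theorem stub_gcSharpOfAHM : (∀ (U μ g : ℝ), 0 ≤ U → 0 < g → ∃ e : ℝ → ℝ, (∀ h : ℝ, 0 ≤ h → Filter.Tendsto (fun L : ℕ => Matrix.groundEnergy (dWaveSourceTorus (L + 1) U μ h) / ((L + 1 : ℕ) : ℝ) ^ 2) Filter.atTop (nhds (e h))) ∧ Filter.Tendsto (fun L : ℕ => Matrix.groundEnergy (hubbardTorusWith 2 (L + 1) 1 U μ - ((g / ((L + 1 : ℕ) : ℝ) ^ 2 : ℝ) : ℂ) • (Matrix.conjTranspose (pairField dWaveFormFactor (L + 1)) * pairField dWaveFormFactor (L +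 1))) / ((L + 1 : ℕ) : ℝ) ^ 2) Filter.atTop (nhds (⨅ h : {h : ℝ // 0 ≤ h}, e h + (h : ℝ) ^ 2 / g))) → ∀ (U μ : ℝ), 0 ≤ U → ∀ ε : ℝ, 0 < ε → ∃ t₀ : ℝ, 0 < t₀ ∧ ∀ t ∈ Set.Ioo (0:ℝ) t₀, ∃ L₀ : ℕ, ∀ (L : ℕ) [NeZero L], L₀ ≤ L → (hubbardTorusWith 2 L 1 U μ).groundEnergy - (hubbardTorusWith 2 L 1 U μ - ((t / (L : ℝ) ^ 2 : ℝ) : ℂ) • ((pairField dWaveFormFactor L)ᴴ * pairField dWaveFormFactor L)).groundEnergy ≤ t * (dWaveOrderParameter U μ ^ 2 + ε) * (L : ℝ) ^ 2 := by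
  intro hAHM U μ hU ε hε
  -- the a priori constant `B = 4√2`
  obtain ⟨B, hB, hFB, hdB⟩ : ∃ B : ℝ, 0 ≤ B ∧
      (∀ h : ℝ, 0 ≤ h → liminf (fun L : ℕ => dWaveSourceDensity (L + 1) U μ h) atTop ≤ B) ∧
      (∀ (L : ℕ) (h : ℝ), dWaveSourceDensity (L + 1) U μ h ≤ B) :=
    ⟨_, (liminf_dWaveSourceDensity_nonneg U μ le_rfl).trans
      (liminf_dWaveSourceDensity_le_const U μ le_rfl),
      fun h hh => liminf_dWaveSourceDensity_le_const U μ hh,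
      fun L h => dWaveSourceDensity_le_const _ U μ h⟩
  -- the order parameter and the auxiliary tolerance `ε₁`
  have hm : 0 ≤ dWaveOrderParameter U μ := dWaveOrderParameter_nonneg U μ
  have hiInf := dWaveOrderParameter_eq_iInf U μ
  set m : ℝ := dWaveOrderParameter U μ with hm_def
  set ε₁ : ℝ := min 1 (ε / (2 * m + 2)) with hε₁_def
  have hε₁ : 0 < ε₁ := lt_min one_pos (div_pos hε (by positivity))
  have hε₁1 : ε₁ ≤ 1 := min_le_left _ _
  have hε₁2 : ε₁ * (2 * m + 2) ≤ ε := by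
    have := min_le_right 1 (ε / (2 * m + 2))
    rwa [le_div_iff₀ (by positivity)] at this
  have hkey : (m + ε₁) ^ 2 + ε₁ ≤ m ^ 2 + ε := by nlinarith
  -- a stair `h₀ > 0` with `F(h₀) < m + ε₁`
  haveI : Nonempty (Set.Ioi (0 : ℝ)) := ⟨⟨1, Set.mem_Ioi.2 one_pos⟩⟩
  have hlt : (⨅ h : Set.Ioi (0 : ℝ), liminf (fun L : ℕ => dWaveSourceDensity (L + 1) U μ h) atTop) <
      m + ε₁ := by
    rw [← hiInf]
    linarith
  obtain ⟨⟨h₀, hh₀⟩, hF⟩ := exists_lt_of_ciInf_lt hlt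
  have hh₀' : 0 < h₀ := hh₀
  -- the threshold `t₀ = h₀/(2B+1)`
  refine ⟨h₀ / (2 * B + 1), by positivity, ?_⟩
  intro t ht
  have ht0 : 0 < t := ht.1
  have htB : t * (2 * B + 1) ≤ h₀ := ((lt_div_iff₀ (by positivity)).1 ht.2).le
  obtain ⟨e, he, hq⟩ := hAHM U μ t hU ht0
  have hc : ∀ L : ℕ, (0 : ℝ) < ((L + 1 : ℕ) : ℝ) ^ 2 := fun L => by positivity
  -- (ii) the lower sandwich in the limit: `e 0 - e h ≤ 2h F(h)`
  have hD1 : ∀ h : ℝ, 0 < h →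
      e 0 - e h ≤ 2 * h * liminf (fun L : ℕ => dWaveSourceDensity (L + 1) U μ h) atTop := by
    intro h hh
    exact sub_le_mul_liminf (E := fun (L : ℕ) (h : ℝ) => (dWaveSourceTorus (L + 1) U μ h).groundEnergy)
      (c := fun L : ℕ => ((L + 1 : ℕ) : ℝ) ^ 2) (d := fun L : ℕ => dWaveSourceDensity (L + 1) U μ h)
      hh hc (he 0 le_rfl) (he h hh.le)
      (fun L => energyGain_div_le_dWaveSourceDensity U μ hh) (fun L => hdB L h)
  -- (iii) chord monotonicity in the limit
  have hD2 : ∀ h h₂ : ℝ, 0 < h → h < h₂ → h₂ * (e 0 - e h) ≤ h * (e 0 - e h₂) := by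
    intro h h₂ hh hlt2
    exact chord_mono_of_tendsto (E := fun (L : ℕ) (h : ℝ) => (dWaveSourceTorus (L + 1) U μ h).groundEnergy)
      (c := fun L : ℕ => ((L + 1 : ℕ) : ℝ) ^ 2) hc (he 0 le_rfl) (he h hh.le)
      (he h₂ (hh.trans hlt2).le) (fun L => chord_mono_finite (L + 1) U μ hh hlt2)
  -- (iv) small sources: `e 0 - e h ≤ 2h(m + ε₁)` on `(0, h₀]`
  have hD0 : e 0 - e h₀ ≤ 2 * h₀ * (m + ε₁) := by
    refine (hD1 h₀ hh₀').trans ?_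
    exact mul_le_mul_of_nonneg_left hF.le (by positivity)
  have hsmall : ∀ h : ℝ, 0 < h → h ≤ h₀ → e 0 - e h ≤ 2 * h * (m + ε₁) := by
    intro h hh hle
    rcases hle.eq_or_lt with rfl | hlt2
    · exact hD0
    have h1 := hD2 h h₀ hh hlt2
    have h2 : h * (e 0 - e h₀) ≤ h * (2 * h₀ * (m + ε₁)) := mul_le_mul_of_nonneg_left hD0 hh.le
    have h3 : h₀ * (e 0 - e h) ≤ h₀ * (2 * h * (m + ε₁)) := by nlinarith
    exact le_of_mul_le_mul_left h3 hh₀'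
  -- (v) all sources: `e 0 - e h ≤ 2hB`
  have hlarge : ∀ h : ℝ, 0 < h → e 0 - e h ≤ 2 * h * B := by
    intro h hh
    refine (hD1 h hh).trans ?_
    exact mul_le_mul_of_nonneg_left (hFB h hh.le) (by positivity)
  -- (vi) completing the square under the infimum
  have hinf := sub_mul_sq_le_ciInf (e := e) ht0 htB hsmall hlarge
  -- (vii) back to finite volume
  have h0 := he 0 le_rfl
  simp only [dWaveSourceTorus_zero] at h0
  have hgain := h0.sub hq
  have hlt2 : e 0 - (⨅ h : {h : ℝ // 0 ≤ h}, e h + (h : ℝ) ^ 2 / t) < t * (m ^ 2 + ε) := by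
    have : t * ((m + ε₁) ^ 2 + ε₁) ≤ t * (m ^ 2 + ε) := mul_le_mul_of_nonneg_left hkey ht0.le
    nlinarith
  obtain ⟨N, hN⟩ := eventually_atTop.1 (hgain.eventually_lt_const hlt2)
  refine ⟨N + 1, fun L _ hL => ?_⟩
  obtain ⟨n, rfl⟩ : ∃ n, L = n + 1 := Nat.exists_eq_succ_of_ne_zero (NeZero.ne L)
  have h1 := hN n (by omega)
  rw [← sub_div, div_lt_iff₀ (hc n)] at h1
  exact h1.le

end Summit.HubbardSuperconductivity.HubbardSuperconductivity.Theorems.WcbcsSsbToTorusLRO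

end
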